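import Summits.QuantumFields.BalabanUV.Beta.CombFormSlotGaugeLetter

/-!
# `BalabanUV.Beta.CombLamSectorLetters` — binder row D1, the DICTIONARY's (J-a) supply for road «FP»'s door at the literal of record:
# **THE Λ-SECTOR OF THE CHART-(III′) LITERAL's FIRST-ORDER MEMBER IS GAUGE-NULL, FIELD–FIELD-SUPPORTED, BLOCK-TRANSLATION-COVARIANT AND
# SIGNED-TRANSPOSE-ODD AT EVERY LEVEL — HYPOTHESES DISCHARGED AT an1's (0.4) RECORD — SO THE FULL FIRST-ORDER MEMBER OBEYS THE PER-SITE GAUGE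
# LETTER OF ITS FORM SLOT AND ITS BORDER SLOT ALONE, AND ITS FIELD–FIELD BLOCK THAT OF THE FORM SLOT ALONE**

WHY (road «FP», route T, the (J-a) TABLE `gen39/JA-TABLE.v1_1.md` §3 (δ) ∕ OPEN QUESTION; leaf-02 g21 W-d1leaf02-g21-4 journal l.43646: «the door is GENERIC in
`H₁` and must be fed the literal's FULL first-order ff jet … `H₁ := w₀ • (Wilson family) + cΛ • (periodised SLam-jet family)` — every row is LINEAR in `H₁`,
hence splits additively: `k1` = leaf-05's commutator letter (Wilson) + «`H₁^Λ` along `Dλ` vanishes» …, `hH₁t` = `torus_H1_transpose` + the Λ family's `trK`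
antisymmetry … (β) will DISPLAY the Λ-sector letters it cannot yet discharge rather than drop the sector»; W-an2-g39-10 l.43684: the letters exist BY
NAME generically).  THIS FILE instantiates them AT THE LITERAL, per fine site, every level, with the generic lemmas' hypotheses (`Decays A`, `VertexFamily H`,
translation ∕ parity of `H`) DISCHARGED from the tree's resolvent letters and an1's record — [folklore] over OUR typed objects, BY NAME:
(1) §1 (generic `d`, any Hessian table `H` with the named letter): **(Λ-g)** `divV (SLam Lc (lamCoeffOf KInv Lc) H) u = 0` (level `0`; leaf-10's
    `WardLocusStencils.divV_SLam_lamCoeffOf_eq_zero` fed `OneStepResolventKernel.decays_KInv` and (LH)) and `divV (SLam Lc (lamCoeffK (KInvStep Lc j) (E2 d Lc j) Lc) H) u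
    = 0` (every level `j`; `WardLocusStep.divV_SLam_lamCoeffK_E2_eq_zero` fed `OneStepKernelFamily.decays_KInvStep`); **(Λ-t)** block-translation covariance of both
    families (`InterLevelTransport.SLam_translate` fed `lamCoeffOf_translate ∕ shiftK_KInv`, `lamCoeffK_translate ∕ shiftK_KInvStep ∕ shiftK_E2` and (TH)); **(Λ-p)**
    `trK (SLam Lc c H κ u) = −sgnK (…)` for ANY conversion coefficients `c` under (H-p) (leaf-05's `SpineRecursiveParity.parityOdd_SLam`); **(Λ-ff)** the Λ family
    vanishes off the field–field block whenever `H` does (`BubbleParity.SLam_apply_eq_zero`).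
(2) §2 (`d + 1 = 4`, any table record `tabs : SymTables 3 Lc`): the divergence of the literal's FULL first-order member `(JsB12CombSh0 hLc N tabs cΛ cB j).S`
    SECTOR BY SECTOR — level `0`: `= Lc⁴ • divV wilsonA u + (−Lc⁸∕2) • divV tabs.V u` (`WardLocusSymShift.divV_S0NOf`); level `j+1`:
    `= (Lc⁴·wE (j+1)) • divV (e3OfK Lc (GcombSh Lc j) (… j).S) u + (−Lc⁸∕2·wVH (j+1)) • divV tabs.V u` (leaf-05's `RecursiveStencilSlot.divV_SrecOf_succ`) — NO Λ-PART;
    and the Λ-SECTOR WEIGHT in the road's currency (border slot at weight `1`): `cΛ·wΛ_j = (λ·wVH_j)·(cVH·wVH_j)` with `λ := −2cΛ∕Lc⁸ = cΛ∕cVH` (`lamWeight_eq`;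
    `wΛ = wVH²`), `= −4∕Lc¹²` at the lock `cΛ·Lc⁴ = 2` (`lamWeight_eq_of_lock`) — the companion of `CombFormSlotGaugeLetter.formWeight_eq` (`w_j = −2·c_j·wVH_j`).
(3) §3 AT an1's CLOSED RECORD `symTablesAn1S2 3 Lc cΛ` (the tables of ROOT M‴'s literal), UNCONDITIONAL: the four Λ-letters instantiated at `H = symHessFFAt ρ_c Lc`
    (`…_an1TablesS2`), and **THE FULL FIRST-ORDER MEMBER's PER-SITE GAUGE LETTER, EXPLICIT**: level `j+1`
    `divV S_{j+1} u = (Lc⁴·wE (j+1)) • (½ • conjV (E2 3 Lc (j+1)) (diagK (legInd ρ′ u))) + (−Lc⁸∕2·wVH (j+1)) • conjV (mfNeg (linSym04At ρ_c Lc)) (diagK (legInd ρ_c u))`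
    (form slot by `CombFormSlotGaugeLetter.divV_formSlot_JsB12CombSh0_an1TablesS2`, border slot by an1's (S-V)⁰⁴ `divV_symVhSAt_eq_conjV_ctr`), level `0` the same with
    leaf-05's `divV_wilsonA_eq_conjV`; and ENTRYWISE ON THE FIELD–FIELD BLOCK (the door's `H₁ :=` FULL ff jet): `(divV S_{j+1} u) x z (inl a) (inl b) =
    (Lc⁴·wE (j+1)) · ½ · E2 3 Lc (j+1) x z (inl a) (inl b) · ([z = u] − [x = u])` and `(divV S₀ u) x z (inl a) (inl b) = Lc⁴ · (divV wilsonA u) x z (inl a) (inl b)`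
    — the border slot has no field–field block (`mfNeg`∕`linSym04At_inl_inl`, (V-ff0)) and the Λ-sector no divergence, so ON THE ff BLOCK THE FULL MEMBER's GAUGE
    LETTER IS THE FORM SLOT's ALONE: feeding the door `H₁ :=` the full ff first-order jet changes neither the transport `X = −c_j • E_λ` nor the `k1` row.
WHAT THIS GIVES ROAD «FP» ∕ leaf-02's (β): the Λ-sector letters (Λ-g)(Λ-t)(Λ-p)(Λ-ff) and the full-member readings BY NAME at the literal, stencil side (infinite
lattice, per fine site); their periodisation is the road's (pattern `PeriodisedBorderIndexWard.sum_tgrad_mul_perZ_dper_of_indexLaw`).  WHAT THIS IS NOT: not a statement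
about Bałaban's papers; not the torus rows; not `D1Tel`; the numerals are the tree's PROVISIONAL pins; NOT D1, NOT `BetaPertH`, NOT continuum, NOT Clay.
HONEST FRAMING (cell contract, verbatim): «discharging `BetaPertH` makes Bałaban's UV stability UNCONDITIONAL — a real constructive-QFT
result; it is NOT the continuum limit and NOT the Clay problem.»  HONEST DEPENDENCY: continuum YM on T⁴ ⇐ BetaPertH ∧ nine spine estimates (0/9 proved);
BetaPertH ⇐ (D1) ∧ (D4) ∧ CAP+tail; G-an2-4 gates asym, D1 and NE2/3/4.
DERIVED cell leaf ([folklore] BY NAME; β sub-cell, BINDER-OWNERS row D1 OWNER `b2b-balaban-beta-an2` gen 40).  No statement of Bałaban's papers, no `[cite:]`, no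
`Prop` fact, no `def`.  Provenance: β sub-cell, unit beta-an2 gen 40, 2026-08-22 (v1); over leaf-10's `WardLocusStencils` ∕ `WardLocusStep`, leaf-05's
`RecursiveStencilSlot` ∕ `SpineRecursiveParity` ∕ `WilsonDivergenceContact`, an2's `WardLocusSymShift` ∕ `CombFormSlotGaugeLetter` ∕ `CombChartStepJets` ∕ `BubbleParity`, an1's
`SymAveragingHessianCounts` ∕ `SymTablesAn1FirstOrder` ∕ `SymSecondOrderTablesAn1`, Literature `InterLevelTransport` ∕ `BalabanStepJets(Succ)` ∕
`OneStepResolventKernel` ∕ `OneStepKernelFamily` BY NAME; no existing file touched.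
-/

noncomputable section

open Finset
open scoped BigOperators
open Literature.MathematicalPhysics.QuantumFieldTheory
open Literature.MathematicalPhysics.QuantumFieldTheory.Balaban1983to89
open Literature.MathematicalPhysics.QuantumFieldTheory.Balaban1983to89.Beta
open ExpKernelCalculus (MKer Decays VertexFamily shiftK)
open OneStepResolventKernel (Fib KInv decays_KInv shiftK_KInv)
open OneStepKernelFamily (KInvStep decays_KInvStep shiftK_KInvStep)
open KernelWard (divV)
open StepJetData (mfNeg mfNeg_inl_inl wilsonA)
open AveragingContoursRooted (ctr)
open BalabanStepJets (lamCoeffOf lamCoeffOf_translate)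
open BalabanStepJetsSucc (wE wVH wΛ E2 lamCoeffK lamCoeffK_translate shiftK_E2)
open InterLevelTransport (SLam SLam_translate)
open Summit.QuantumFields.BalabanUV.Beta.TameKernelCalculus (trK)
open Summit.QuantumFields.BalabanUV.Beta.BorderedHessian (sgnK stepScale diagK conjV_diagK_apply bhKAt)
open Summit.QuantumFields.BalabanUV.Beta.ChartConjugation (conjV)
open Summit.QuantumFields.BalabanUV.Beta.AxialDressingRooted (one_le_of_neZero)
open Summit.QuantumFields.BalabanUV.Beta.AveragingWardRootedStencils (legInd legInd_inl)
open Summit.QuantumFields.BalabanUV.Beta.WardLocusStencils (ffK divV_apply divV_SLam_lamCoeffOf_eq_zero)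
open Summit.QuantumFields.BalabanUV.Beta.WardLocusStep (divV_SLam_lamCoeffK_E2_eq_zero)
open Summit.QuantumFields.BalabanUV.Beta.WardLocusRecursive (SrecOf SrecOf_zero SrecOf_succ e3OfK_eq_e3K)
open Summit.QuantumFields.BalabanUV.Beta.SpineRooted (e3OfK S0NOf divV_SrecOf_succ)
open Summit.QuantumFields.BalabanUV.Beta.WardLocusSymShift (divV_S0NOf)
open Summit.QuantumFields.BalabanUV.Beta.SpineRecursiveParity (parityOdd_SLam)
open Summit.QuantumFields.BalabanUV.Beta.BubbleParity (SLam_apply_eq_zero)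
open Summit.QuantumFields.BalabanUV.Beta.WilsonDivergenceContact (divV_wilsonA_eq_conjV)
open Summit.QuantumFields.BalabanUV.Beta.SymmetrisedStepJets (SymTables)
open Summit.QuantumFields.BalabanUV.Beta.DshAn1 (linSym04At linSym04At_inl_inl)
open Summit.QuantumFields.BalabanUV.Beta.CombChartStepJets (GcombSh ScombOf_eq JsComb0Of_S JsB12CombSh0 JsB12CombSh0_eq)
open Summit.QuantumFields.BalabanUV.Beta.SymAveragingHessianCounts (symVhSAt symVhSAt_inl_inl symHessFFAt symHessFFAt_inl_inr symHessFFAt_inr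
  symHessFFAt_translate)
open Summit.QuantumFields.BalabanUV.Beta.SymTablesAn1FirstOrder (trK_symHessFFAt)
open Summit.QuantumFields.BalabanUV.Beta.SymSecondOrderTablesAn1 (symTablesAn1S2 symTablesAn1S2_V symTablesAn1S2_H)
open Summit.QuantumFields.BalabanUV.Beta.SymAveragingWardRootedStencils (divV_symVhSAt_eq_conjV_ctr)
open Summit.QuantumFields.BalabanUV.Beta.CombFormSlotGaugeLetter (divV_formSlot_JsB12CombSh0_an1TablesS2)

namespace Summit.QuantumFields.BalabanUV.Beta.CombLamSectorLetters

variable {d : ℕ}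

/-! ## §1 The Λ-sector letters, generic `d`: gauge-null (both coefficient families), translation, parity, field–field support -/

section Generic

variable {Lc : ℕ} [NeZero Lc] {H : Fin (d + 1) → (Fin (d + 1) → ℤ) → MKer (d + 1) (Fib d)}

/-- [folklore] **(Λ-g)₀ THE LEVEL-`0` Λ-SECTOR IS GAUGE-NULL, PER FINE SITE**, for any Hessian table `H` with (LH) at every rate:
`divV (SLam Lc (lamCoeffOf KInv Lc) H) u = 0` (leaf-10's `divV_SLam_lamCoeffOf_eq_zero` fed `decays_KInv`). -/
theorem divV_SLam_lamCoeffOf_KInv_eq_zero (hH : ∀ δ : ℝ, 0 ≤ δ → ∃ C : ℝ, VertexFamily H Lc C δ) (u : Fin (d + 1) → ℤ) :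
    divV (SLam Lc (lamCoeffOf (KInv (N := Lc) (d := d)) Lc) H) u = 0 := by
  obtain ⟨δ₀, C, hδ₀, hC, hdec⟩ := decays_KInv (N := Lc) (d := d)
  obtain ⟨Cq, hQ⟩ := hH δ₀ hδ₀.le
  exact divV_SLam_lamCoeffOf_eq_zero (N := Lc) hdec hC hδ₀ hQ u

/-- [folklore] **(Λ-g)ⱼ THE LEVEL-`j` Λ-SECTOR IS GAUGE-NULL, PER FINE SITE, AT EVERY LEVEL** (the literal uses it at `j+1`), for any `H` with (LH) at every
rate: `divV (SLam Lc (lamCoeffK (KInvStep Lc j) (E2 d Lc j) Lc) H) u = 0` (`divV_SLam_lamCoeffK_E2_eq_zero` fed `decays_KInvStep`). -/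
theorem divV_SLam_lamCoeffK_KInvStep_eq_zero (hH : ∀ δ : ℝ, 0 ≤ δ → ∃ C : ℝ, VertexFamily H Lc C δ) (j : ℕ) (u : Fin (d + 1) → ℤ) :
    divV (SLam Lc (lamCoeffK (KInvStep (d := d) Lc j) (E2 d Lc j) Lc) H) u = 0 := by
  obtain ⟨δA, CA, hδA, _hCA, hA⟩ := decays_KInvStep (Lc := Lc) (d := d) j
  obtain ⟨Cq, hQ⟩ := hH δA hδA.le
  exact divV_SLam_lamCoeffK_E2_eq_zero (Lc := Lc) (N := Lc) j hA hδA hQ hδA u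

/-- [folklore] **(Λ-t)₀ BLOCK-TRANSLATION COVARIANCE OF THE LEVEL-`0` Λ-SECTOR** under (TH): `SΛ₀ κ (u + Lc•t) = shiftK (−Lc•t) (SΛ₀ κ u)`
(`SLam_translate` fed `lamCoeffOf_translate`∕`shiftK_KInv`). -/
theorem SLam_lamCoeffOf_KInv_translate (hHt : ∀ (μ : Fin (d + 1)) (y t : Fin (d + 1) → ℤ), H μ (y + t) = shiftK (-((Lc : ℤ) • t)) (H μ y))
    (κ : Fin (d + 1)) (u t : Fin (d + 1) → ℤ) :
    SLam Lc (lamCoeffOf (KInv (N := Lc) (d := d)) Lc) H κ (u + (Lc : ℤ) • t)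
      = shiftK (-((Lc : ℤ) • t)) (SLam Lc (lamCoeffOf (KInv (N := Lc) (d := d)) Lc) H κ u) :=
  SLam_translate (N := Lc) (c := lamCoeffOf (KInv (N := Lc) (d := d)) Lc) (Q2 := H)
    (fun μ y κ' u' t' => lamCoeffOf_translate (fun s => shiftK_KInv (N := Lc) (d := d) s) μ y κ' u' t') hHt κ u t

/-- [folklore] **(Λ-t)ⱼ BLOCK-TRANSLATION COVARIANCE OF THE LEVEL-`j` Λ-SECTOR** under (TH) (`SLam_translate` fed `lamCoeffK_translate`∕`shiftK_KInvStep`∕`shiftK_E2`). -/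
theorem SLam_lamCoeffK_KInvStep_translate (hHt : ∀ (μ : Fin (d + 1)) (y t : Fin (d + 1) → ℤ), H μ (y + t) = shiftK (-((Lc : ℤ) • t)) (H μ y))
    (j : ℕ) (κ : Fin (d + 1)) (u t : Fin (d + 1) → ℤ) :
    SLam Lc (lamCoeffK (KInvStep (d := d) Lc j) (E2 d Lc j) Lc) H κ (u + (Lc : ℤ) • t)
      = shiftK (-((Lc : ℤ) • t)) (SLam Lc (lamCoeffK (KInvStep (d := d) Lc j) (E2 d Lc j) Lc) H κ u) :=
  SLam_translate (N := Lc) (c := lamCoeffK (KInvStep (d := d) Lc j) (E2 d Lc j) Lc) (Q2 := H)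
    (fun μ y κ' u' t' => lamCoeffK_translate (fun s => shiftK_KInvStep (d := d) (Lc := Lc) j s)
      (fun s => shiftK_E2 (d := d) (Lc := Lc) j (-((Lc : ℤ) • s))) μ y κ' u' t') hHt κ u t

omit [NeZero Lc] in
/-- [folklore] **(Λ-p) THE Λ-SECTOR IS SIGNED-TRANSPOSE-ODD** for ANY conversion coefficients `c`, under (H-p) (leaf-05's `SpineRecursiveParity.parityOdd_SLam`):
`trK (SLam Lc c H κ u) = −sgnK (SLam Lc c H κ u)`. -/
theorem trK_SLam (hHp : ∀ (μ : Fin (d + 1)) (y : Fin (d + 1) → ℤ), trK (H μ y) = -sgnK (H μ y))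
    (c : Fin (d + 1) → (Fin (d + 1) → ℤ) → Fin (d + 1) → (Fin (d + 1) → ℤ) → ℝ) (κ : Fin (d + 1)) (u : Fin (d + 1) → ℤ) :
    trK (SLam Lc c H κ u) = -sgnK (SLam Lc c H κ u) :=
  parityOdd_SLam Lc c hHp κ u

omit [NeZero Lc] in
/-- [folklore] **(Λ-ff) THE Λ-SECTOR IS FIELD–FIELD-SUPPORTED WHENEVER `H` IS**: for ANY `c`, if `H μ y x z a b = 0` for all `μ y x z` then
`SLam Lc c H κ u x z a b = 0` (`SLam_apply_eq_zero`). -/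
theorem SLam_apply_eq_zero_of_table (c : Fin (d + 1) → (Fin (d + 1) → ℤ) → Fin (d + 1) → (Fin (d + 1) → ℤ) → ℝ) {a b : Fib d}
    (h : ∀ (μ : Fin (d + 1)) (y x z : Fin (d + 1) → ℤ), H μ y x z a b = 0) (κ : Fin (d + 1)) (u x z : Fin (d + 1) → ℤ) :
    SLam Lc c H κ u x z a b = 0 :=
  SLam_apply_eq_zero (N := Lc) h κ u x z

end Generic

/-! ## §2 `d + 1 = 4`: the divergence of the literal's FULL first-order member, sector by sector (no Λ-part), and the Λ-sector weight -/

section FourD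

variable {Lc : ℕ} [NeZero Lc]

/-- [folklore] **LEVEL `0`: THE DIVERGENCE OF THE LITERAL's FULL FIRST-ORDER MEMBER HAS A WILSON AND A BORDER SECTOR ONLY** (any table record):
`divV (JsB12CombSh0 … 0).S u = Lc⁴ • divV wilsonA u + (−Lc⁸∕2) • divV tabs.V u` (`WardLocusSymShift.divV_S0NOf` at the pins). -/
theorem divV_S_zero (hLc : Odd Lc) (N : ℕ) (tabs : SymTables 3 Lc) (cΛ cB : ℝ) (u : Fin 4 → ℤ) :
    divV (JsB12CombSh0 hLc N tabs cΛ cB 0).S u = ((Lc : ℝ) ^ 4) • divV (wilsonA 3) u + (-((Lc : ℝ) ^ 8 / 2)) • divV tabs.V u := by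
  rw [JsB12CombSh0_eq, JsComb0Of_S, ScombOf_eq, SrecOf_zero]
  exact divV_S0NOf tabs.hH _ _ cΛ u

/-- [folklore] **LEVEL `j+1`: THE DIVERGENCE OF THE LITERAL's FULL FIRST-ORDER MEMBER HAS A FORM-SLOT AND A BORDER SECTOR ONLY** (any table record):
`divV (JsB12CombSh0 … (j+1)).S u = (Lc⁴·wE (j+1)) • divV (e3OfK Lc (GcombSh Lc j) (JsB12CombSh0 … j).S) u + (−Lc⁸∕2·wVH (j+1)) • divV tabs.V u`
(leaf-05's `RecursiveStencilSlot.divV_SrecOf_succ` at the (III′) resolvents and pins). -/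
theorem divV_S_succ (hLc : Odd Lc) (N : ℕ) (tabs : SymTables 3 Lc) (cΛ cB : ℝ) (j : ℕ) (u : Fin 4 → ℤ) :
    divV (JsB12CombSh0 hLc N tabs cΛ cB (j + 1)).S u =
      ((Lc : ℝ) ^ 4 * wE 3 Lc (j + 1)) • divV (e3OfK Lc (GcombSh (d := 3) Lc j) (JsB12CombSh0 hLc N tabs cΛ cB j).S) u
        + (-((Lc : ℝ) ^ 8 / 2) * wVH 3 Lc (j + 1)) • divV tabs.V u := by
  have hH1 : ∃ C δ : ℝ, 0 < δ ∧ VertexFamily tabs.H Lc C δ := by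
    obtain ⟨C, hC⟩ := tabs.hH 1 zero_le_one
    exact ⟨C, 1, one_pos, hC⟩
  have h := divV_SrecOf_succ (V := tabs.V) (G := GcombSh (d := 3) Lc) hH1 ((Lc : ℝ) ^ 4) (-((Lc : ℝ) ^ 8 / 2)) cΛ j u
  rw [← e3OfK_eq_e3K] at h
  rw [JsB12CombSh0_eq, JsComb0Of_S, JsComb0Of_S, ScombOf_eq]
  exact h

/-- [folklore] **THE Λ-SECTOR WEIGHT IN THE ROAD's CURRENCY** (border slot at weight `1`; companion of `CombFormSlotGaugeLetter.formWeight_eq`): with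
`λ := −2cΛ∕Lc⁸` (`= cΛ∕cVH`, `cVH = −Lc⁸∕2`), `cΛ·wΛ_j = (λ·wVH_j)·(cVH·wVH_j)` — the Λ family of member `j` enters the door's `H₁` at weight `λ·wVH_j`
(`wΛ = wVH²`; at level `0`: `λ`). -/
theorem lamWeight_eq (cΛ : ℝ) (j : ℕ) :
    cΛ * wΛ 3 Lc j = (-(2 * cΛ) / (Lc : ℝ) ^ 8 * wVH 3 Lc j) * (-((Lc : ℝ) ^ 8 / 2) * wVH 3 Lc j) := by
  have hL : (Lc : ℝ) ≠ 0 := Nat.cast_ne_zero.2 (NeZero.ne Lc)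
  have hw : wΛ 3 Lc j = wVH 3 Lc j * wVH 3 Lc j := by
    unfold BalabanStepJetsSucc.wΛ BalabanStepJetsSucc.wVH
    ring
  rw [hw]
  field_simp

/-- [folklore] **AT THE LOCK `cΛ·Lc⁴ = 2`** the Λ-sector weight is `λ = −4∕Lc¹²`: `cΛ·wΛ_j = (−4∕Lc¹²·wVH_j)·(−Lc⁸∕2·wVH_j)`. -/
theorem lamWeight_eq_of_lock {cΛ : ℝ} (hΛ : cΛ * (Lc : ℝ) ^ 4 = 2) (j : ℕ) :
    cΛ * wΛ 3 Lc j = (-(4 : ℝ) / (Lc : ℝ) ^ 12 * wVH 3 Lc j) * (-((Lc : ℝ) ^ 8 / 2) * wVH 3 Lc j) := by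
  have hL : (Lc : ℝ) ≠ 0 := Nat.cast_ne_zero.2 (NeZero.ne Lc)
  have hc : cΛ = 2 / (Lc : ℝ) ^ 4 := by
    rw [eq_div_iff (pow_ne_zero _ hL)]
    exact hΛ
  rw [lamWeight_eq, hc]
  field_simp
  ring

end FourD

/-! ## §3 AT an1's CLOSED (0.4) RECORD `symTablesAn1S2 3 Lc cΛ`: the Λ-letters instantiated, and the full member's per-site gauge letter, explicit -/

section Record

variable {Lc : ℕ} [NeZero Lc]

/-- [folklore] **(Λ-g)₀ AT THE RECORD, UNCONDITIONAL**: `divV (SLam Lc (lamCoeffOf KInv Lc) (symHessFFAt ρ_c Lc)) u = 0` (generic `d`; (LH) = an1's record letter). -/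
theorem divV_SLam_lamCoeffOf_an1TablesS2_eq_zero (cΛ : ℝ) (u : Fin (d + 1) → ℤ) :
    divV (SLam Lc (lamCoeffOf (KInv (N := Lc) (d := d)) Lc) (symHessFFAt (ctr (d + 1) Lc) Lc)) u = 0 := by
  rw [← symTablesAn1S2_H (d := d) (Lc := Lc) cΛ]
  exact divV_SLam_lamCoeffOf_KInv_eq_zero (symTablesAn1S2 d Lc cΛ).hH u

/-- [folklore] **(Λ-g)ⱼ AT THE RECORD, UNCONDITIONAL, EVERY LEVEL**: `divV (SLam Lc (lamCoeffK (KInvStep Lc j) (E2 d Lc j) Lc) (symHessFFAt ρ_c Lc)) u = 0`. -/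
theorem divV_SLam_lamCoeffK_an1TablesS2_eq_zero (cΛ : ℝ) (j : ℕ) (u : Fin (d + 1) → ℤ) :
    divV (SLam Lc (lamCoeffK (KInvStep (d := d) Lc j) (E2 d Lc j) Lc) (symHessFFAt (ctr (d + 1) Lc) Lc)) u = 0 := by
  rw [← symTablesAn1S2_H (d := d) (Lc := Lc) cΛ]
  exact divV_SLam_lamCoeffK_KInvStep_eq_zero (symTablesAn1S2 d Lc cΛ).hH j u

/-- [folklore] **(Λ-t) AT THE RECORD** (both coefficient families; (TH) = an1's `symHessFFAt_translate`). -/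
theorem SLam_an1TablesS2_translate (j : ℕ) (κ : Fin (d + 1)) (u t : Fin (d + 1) → ℤ) :
    SLam Lc (lamCoeffOf (KInv (N := Lc) (d := d)) Lc) (symHessFFAt (ctr (d + 1) Lc) Lc) κ (u + (Lc : ℤ) • t)
        = shiftK (-((Lc : ℤ) • t)) (SLam Lc (lamCoeffOf (KInv (N := Lc) (d := d)) Lc) (symHessFFAt (ctr (d + 1) Lc) Lc) κ u)
      ∧ SLam Lc (lamCoeffK (KInvStep (d := d) Lc j) (E2 d Lc j) Lc) (symHessFFAt (ctr (d + 1) Lc) Lc) κ (u + (Lc : ℤ) • t)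
        = shiftK (-((Lc : ℤ) • t)) (SLam Lc (lamCoeffK (KInvStep (d := d) Lc j) (E2 d Lc j) Lc) (symHessFFAt (ctr (d + 1) Lc) Lc) κ u) :=
  ⟨SLam_lamCoeffOf_KInv_translate (fun μ y t' => symHessFFAt_translate (ctr (d + 1) Lc) μ y t') κ u t,
    SLam_lamCoeffK_KInvStep_translate (fun μ y t' => symHessFFAt_translate (ctr (d + 1) Lc) μ y t') j κ u t⟩

omit [NeZero Lc] in
/-- [folklore] **(Λ-p) AT THE RECORD**, any coefficients `c` ((H-p) = an1's `trK_symHessFFAt`): `trK (SLam Lc c (symHessFFAt ρ_c Lc) κ u) = −sgnK (…)`. -/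
theorem trK_SLam_an1TablesS2 (c : Fin (d + 1) → (Fin (d + 1) → ℤ) → Fin (d + 1) → (Fin (d + 1) → ℤ) → ℝ) (κ : Fin (d + 1))
    (u : Fin (d + 1) → ℤ) :
    trK (SLam Lc c (symHessFFAt (ctr (d + 1) Lc) Lc) κ u) = -sgnK (SLam Lc c (symHessFFAt (ctr (d + 1) Lc) Lc) κ u) :=
  trK_SLam (fun μ y => trK_symHessFFAt (ctr (d + 1) Lc) Lc μ y) c κ u

omit [NeZero Lc] in
/-- [folklore] **(Λ-ff) AT THE RECORD**, any coefficients `c`: the Λ-sector built on `symHessFFAt ρ_c` vanishes on the `(inl, inr)` block … -/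
theorem SLam_an1TablesS2_inl_inr (c : Fin (d + 1) → (Fin (d + 1) → ℤ) → Fin (d + 1) → (Fin (d + 1) → ℤ) → ℝ) (κ : Fin (d + 1))
    (u x z : Fin (d + 1) → ℤ) (α μ : Fin (d + 1)) :
    SLam Lc c (symHessFFAt (ctr (d + 1) Lc) Lc) κ u x z (Sum.inl α) (Sum.inr μ) = 0 :=
  SLam_apply_eq_zero_of_table c (fun μ' y x' z' => symHessFFAt_inl_inr (ctr (d + 1) Lc) Lc μ' y x' z' α μ) κ u x z

omit [NeZero Lc] in
/-- [folklore] … and on the `(inr, ·)` blocks: the Λ family is FIELD–FIELD-SUPPORTED (the door's `H₁` slot loses nothing of it). -/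
theorem SLam_an1TablesS2_inr (c : Fin (d + 1) → (Fin (d + 1) → ℤ) → Fin (d + 1) → (Fin (d + 1) → ℤ) → ℝ) (κ : Fin (d + 1))
    (u x z : Fin (d + 1) → ℤ) (μ : Fin (d + 1)) (b : Fib d) :
    SLam Lc c (symHessFFAt (ctr (d + 1) Lc) Lc) κ u x z (Sum.inr μ) b = 0 :=
  SLam_apply_eq_zero_of_table c (fun μ' y x' z' => symHessFFAt_inr (ctr (d + 1) Lc) Lc μ' y x' z' μ b) κ u x z

/-- [folklore] **THE FULL LEVEL-`(j+1)` MEMBER OF THE LITERAL OF RECORD OBEYS THE PER-SITE GAUGE LETTER, EXPLICITLY** (`d + 1 = 4`; form slot at constant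
`½` against `E2 (j+1)` by `CombFormSlotGaugeLetter`, border slot against the (0.4) linear kernel by an1's (S-V)⁰⁴, Λ-sector NULL): for every level `j`,
root `ρ′`, fine site `u`,
`divV S_{j+1} u = (Lc⁴·wE (j+1)) • (½ • conjV (E2 3 Lc (j+1)) (diagK (legInd ρ′ u))) + (−Lc⁸∕2·wVH (j+1)) • conjV (mfNeg (linSym04At ρ_c Lc)) (diagK (legInd ρ_c u))`. -/
theorem divV_S_succ_an1TablesS2 (hLc : Odd Lc) (N : ℕ) (cΛ cB : ℝ) (j : ℕ) (ρ' u : Fin 4 → ℤ) :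
    divV (JsB12CombSh0 hLc N (symTablesAn1S2 3 Lc cΛ) cΛ cB (j + 1)).S u =
      ((Lc : ℝ) ^ 4 * wE 3 Lc (j + 1)) • ((1 / 2 : ℝ) • conjV (E2 3 Lc (j + 1)) (diagK (legInd ρ' u)))
        + (-((Lc : ℝ) ^ 8 / 2) * wVH 3 Lc (j + 1)) •
            conjV (mfNeg (linSym04At (ctr 4 Lc) Lc)) (diagK (legInd (ctr 4 Lc) u)) := by
  rw [divV_S_succ, divV_formSlot_JsB12CombSh0_an1TablesS2 hLc N cΛ cB j ρ' u, symTablesAn1S2_V,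
    divV_symVhSAt_eq_conjV_ctr (d := 3) (one_le_of_neZero Lc) u]

/-- [folklore] **THE FULL LEVEL-`0` MEMBER OF THE LITERAL OF RECORD OBEYS THE PER-SITE GAUGE LETTER, EXPLICITLY** (Wilson sector by leaf-05's
`divV_wilsonA_eq_conjV`, constant `½`, any root `ρ′` and window `L′`; border sector by (S-V)⁰⁴; Λ-sector NULL):
`divV S₀ u = Lc⁴ • (½ • conjV (ffK (bhKAt 3 ρ′ L′)) (diagK (legInd ρ′ u))) + (−Lc⁸∕2) • conjV (mfNeg (linSym04At ρ_c Lc)) (diagK (legInd ρ_c u))`. -/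
theorem divV_S_zero_an1TablesS2 (hLc : Odd Lc) (N : ℕ) (cΛ cB : ℝ) (ρ' : Fin 4 → ℤ) (L' : ℕ) (u : Fin 4 → ℤ) :
    divV (JsB12CombSh0 hLc N (symTablesAn1S2 3 Lc cΛ) cΛ cB 0).S u =
      ((Lc : ℝ) ^ 4) • ((1 / 2 : ℝ) • conjV (ffK (bhKAt 3 ρ' L')) (diagK (legInd ρ' u)))
        + (-((Lc : ℝ) ^ 8 / 2)) • conjV (mfNeg (linSym04At (ctr 4 Lc) Lc)) (diagK (legInd (ctr 4 Lc) u)) := by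
  rw [divV_S_zero, divV_wilsonA_eq_conjV ρ' L' u, symTablesAn1S2_V, divV_symVhSAt_eq_conjV_ctr (d := 3) (one_le_of_neZero Lc) u]

/-- [folklore] **ON THE FIELD–FIELD BLOCK THE FULL LEVEL-`(j+1)` MEMBER's GAUGE LETTER IS THE FORM SLOT's ALONE, ENTRYWISE** (the border slot has no ff
block — `mfNeg_inl_inl`, `linSym04At_inl_inl` —, the Λ-sector no divergence): `(divV S_{j+1} u) x z (inl a) (inl b) =
(Lc⁴·wE (j+1)) · (½ · (E2 3 Lc (j+1) x z (inl a) (inl b) · ([z = u] − [x = u])))` — the door's `k1` input for `H₁ :=` the FULL ff first-order jet,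
SAME transport and weight as for the form slot alone (`CombFormSlotGaugeLetter.divV_formSlot_JsB12CombSh0_an1TablesS2_inl_inl`). -/
theorem divV_S_succ_an1TablesS2_inl_inl (hLc : Odd Lc) (N : ℕ) (cΛ cB : ℝ) (j : ℕ) (u x z : Fin 4 → ℤ) (a b : Fin 4) :
    divV (JsB12CombSh0 hLc N (symTablesAn1S2 3 Lc cΛ) cΛ cB (j + 1)).S u x z (Sum.inl a) (Sum.inl b) =
      ((Lc : ℝ) ^ 4 * wE 3 Lc (j + 1)) *
        ((1 / 2 : ℝ) * (E2 3 Lc (j + 1) x z (Sum.inl a) (Sum.inl b) * ((if z = u then 1 else 0) - (if x = u then 1 else 0)))) := by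
  have h := congrFun (congrFun (congrFun (congrFun (divV_S_succ_an1TablesS2 hLc N cΛ cB j u u) x) z) (Sum.inl a)) (Sum.inl b)
  rw [h, Pi.add_apply, Pi.add_apply, Pi.add_apply, Pi.add_apply, Pi.smul_apply, Pi.smul_apply, Pi.smul_apply, Pi.smul_apply,
    Pi.smul_apply, Pi.smul_apply, Pi.smul_apply, Pi.smul_apply, Pi.smul_apply, Pi.smul_apply, Pi.smul_apply, Pi.smul_apply, smul_eq_mul,
    smul_eq_mul, smul_eq_mul, conjV_diagK_apply, conjV_diagK_apply, mfNeg_inl_inl, linSym04At_inl_inl, zero_mul, mul_zero, add_zero,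
    legInd_inl, legInd_inl]

/-- [folklore] **ON THE FIELD–FIELD BLOCK THE FULL LEVEL-`0` MEMBER's GAUGE LETTER IS THE WILSON TABLE's ALONE, ENTRYWISE** ((V-ff0) = an1's
`symVhSAt_inl_inl`; Λ-sector NULL): `(divV S₀ u) x z (inl a) (inl b) = Lc⁴ · (divV wilsonA u) x z (inl a) (inl b)` — leaf-05's `divV_wilsonA_inl_inl` is the
door's level-`0` `k1` input unchanged when `H₁ :=` the FULL ff first-order jet of the literal. -/
theorem divV_S_zero_an1TablesS2_inl_inl (hLc : Odd Lc) (N : ℕ) (cΛ cB : ℝ) (u x z : Fin 4 → ℤ) (a b : Fin 4) :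
    divV (JsB12CombSh0 hLc N (symTablesAn1S2 3 Lc cΛ) cΛ cB 0).S u x z (Sum.inl a) (Sum.inl b) =
      ((Lc : ℝ) ^ 4) * divV (wilsonA 3) u x z (Sum.inl a) (Sum.inl b) := by
  have h := congrFun (congrFun (congrFun (congrFun (divV_S_zero hLc N (symTablesAn1S2 3 Lc cΛ) cΛ cB u) x) z) (Sum.inl a)) (Sum.inl b)
  have hV : divV (symTablesAn1S2 3 Lc cΛ).V u x z (Sum.inl a) (Sum.inl b) = 0 := by
    rw [symTablesAn1S2_V, divV_apply]
    simp only [symVhSAt_inl_inl, sub_self, Finset.sum_const_zero]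
  rw [h, Pi.add_apply, Pi.add_apply, Pi.add_apply, Pi.add_apply, Pi.smul_apply, Pi.smul_apply, Pi.smul_apply, Pi.smul_apply, Pi.smul_apply,
    Pi.smul_apply, Pi.smul_apply, Pi.smul_apply, smul_eq_mul, smul_eq_mul, hV, mul_zero, add_zero]

end Record

end Summit.QuantumFields.BalabanUV.Beta.CombLamSectorLetters

end
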